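import Summits.CriticalPhenomena.CardyFormulaZ2.Theorems.CardySusyWardParafermionFamiliesToSLESixWallClassification

/-!
# The concrete anchor family (skeleton r4 of line `strip-anchored-vertex-normalisation`,
# crux stmt-CriticalPhenomena-10814), X: counting the wall corners of `anchorData δ`

Helper file of the stub `stub_anchorMoment_of_IP` (assembly of the boundary first moment): the FINITE-SET
bookkeeping of the wall corners.  A wall corner of the concrete anchor data `E = anchorData δ` at level `L`
(`L δ < 2 ≤ (L + 1) δ`) is an index `q = ((x, i), k)` with `(x, i)` a random both-inner medial vertex
(`IsRandomMV`) whose twin across the `k`-th corner is not; throughout, `T` is any finite set with exactly these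
members (hypothesis `hT`; in the assembly `T` is cut out of `TotalSmall.finite_random`).  In the coordinates
`s = x₀ + x₁`, `d = x₀ - x₁` (`AnchorWall.isRandomMV_iff_zero/one`, `omega`):

* `coords_of_mem`: wall corners live in the diamond, `-(L-1) ≤ s ≤ L-2`, `-(L-1) ≤ d ≤ L-1`;
* `regular_cases`: OFF the four vertex regions `{L-8 ≤ |s|, L-8 ≤ |d|}` a wall corner belongs to one of
  the eight regular families (free side `k = 1`, `s = L-3`; lower-right `k = 2`, `d = L-2 / L-1`;
  upper-left `k = 0`, `d = -(L-1) / -(L-2)`; lower-left `k = 3`, `s = -(L-1)`), well inside the ranges of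
  the phase packages (`|·| ≤ L-9` in the free coordinate);
* `card_exc_le`: the vertex regions carry at most `5832` wall corners (they project into an explicit
  `27 × 27` box of sites);
* `UL_zero_eq` / `UL_one_eq`: the regular upper-left corners are EXACTLY the images of the intervals
  `t ∈ [4, L-5]` (horizontal, `x = (t-(L-1), t)`) and `t ∈ [4, L-6]` (vertical, `x = (t-(L-2), t)`) — the
  parametrisation by the face `F = (t-(L-1), t)` used for the pairing;
* `window_mem` / `card_window`: the free-side corners `((t, L-3-t), 0), k = 1`, `t ∈ [L/4, 3(L/4) - 3]`,
  are regular wall corners whose wall site `(t+1, L-3-t)` lies in S5's window `2|d| ≤ L + 2`, and there are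
  at least `L/4` of them.

All elementary. [folklore]
-/

noncomputable section

namespace Summit.CriticalPhenomena.CardyFormulaZ2.Theorems.ParafermionFamiliesToSLESix.StripAnchored

open Literature.Probability.LatticeModels
open Literature.Barriers.CriticalPhenomena.HalfCRGreen (twin)
open AnchorWall (isRandomMV_iff_zero isRandomMV_iff_one twin_zero twin_one)

namespace AnchorCount

variable {δ : ℝ} {L : ℤ}

section Level

variable (hδ : 0 < δ) (hLδ : (L : ℝ) * δ < 2) (hL1 : 2 ≤ ((L : ℝ) + 1) * δ) (hL : 16 ≤ L)
  {T : Finset ((Site 2 × Fin 2) × Fin 4)}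
  (hT : ∀ q, q ∈ T ↔ IsRandomMV (anchorData δ) q.1 ∧ ¬ IsRandomMV (anchorData δ) (twin q.1.1 q.1.2 q.2))
include hδ hLδ hL1 hL hT

/-! ## Wall corners in coordinates -/

/-- **Wall corners live in the diamond**: `-(L-1) ≤ s ≤ L-2`, `-(L-1) ≤ d ≤ L-1`. [folklore] -/
theorem coords_of_mem {q : (Site 2 × Fin 2) × Fin 4} (hq : q ∈ T) :
    -(L - 1) ≤ q.1.1 0 + q.1.1 1 ∧ q.1.1 0 + q.1.1 1 ≤ L - 2 ∧
      -(L - 1) ≤ q.1.1 0 - q.1.1 1 ∧ q.1.1 0 - q.1.1 1 ≤ L - 1 := by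
  obtain ⟨⟨x, i⟩, k⟩ := q
  obtain ⟨hp, -⟩ := (hT _).1 hq
  dsimp only at hp ⊢
  have hL4 : 4 ≤ L := by omega
  fin_cases i
  · rw [Fin.zero_eta, isRandomMV_iff_zero hδ hLδ hL1 hL4] at hp
    omega
  · rw [Fin.mk_one, isRandomMV_iff_one hδ hLδ hL1 hL4] at hp
    omega

/-- **The regular wall corners, classified.** Off the vertex regions `{L-8 ≤ |s| ∧ L-8 ≤ |d|}`, a wall
corner `((x, i), k)` is in one of the eight regular families, well inside the phase ranges. [folklore] -/
theorem regular_cases {q : (Site 2 × Fin 2) × Fin 4} (hq : q ∈ T)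
    (hreg : ¬ (L - 8 ≤ |q.1.1 0 + q.1.1 1| ∧ L - 8 ≤ |q.1.1 0 - q.1.1 1|)) :
    (q.1.2 = 0 ∧ q.2 = 1 ∧ q.1.1 0 + q.1.1 1 = L - 3 ∧ |q.1.1 0 - q.1.1 1| ≤ L - 9) ∨
    (q.1.2 = 1 ∧ q.2 = 1 ∧ q.1.1 0 + q.1.1 1 = L - 3 ∧ |q.1.1 0 - q.1.1 1| ≤ L - 9) ∨
    (q.1.2 = 0 ∧ q.2 = 2 ∧ q.1.1 0 - q.1.1 1 = L - 2 ∧ |q.1.1 0 + q.1.1 1| ≤ L - 9) ∨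
    (q.1.2 = 1 ∧ q.2 = 2 ∧ q.1.1 0 - q.1.1 1 = L - 1 ∧ |q.1.1 0 + q.1.1 1| ≤ L - 9) ∨
    (q.1.2 = 0 ∧ q.2 = 0 ∧ q.1.1 0 - q.1.1 1 = -(L - 1) ∧ |q.1.1 0 + q.1.1 1| ≤ L - 9) ∨
    (q.1.2 = 1 ∧ q.2 = 0 ∧ q.1.1 0 - q.1.1 1 = -(L - 2) ∧ |q.1.1 0 + q.1.1 1| ≤ L - 9) ∨
    (q.1.2 = 0 ∧ q.2 = 3 ∧ q.1.1 0 + q.1.1 1 = -(L - 1) ∧ |q.1.1 0 - q.1.1 1| ≤ L - 9) ∨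
    (q.1.2 = 1 ∧ q.2 = 3 ∧ q.1.1 0 + q.1.1 1 = -(L - 1) ∧ |q.1.1 0 - q.1.1 1| ≤ L - 9) := by
  obtain ⟨⟨x, i⟩, k⟩ := q
  obtain ⟨hp, hq'⟩ := (hT _).1 hq
  dsimp only at hp hq' hreg ⊢
  have hL4 : 4 ≤ L := by omega
  obtain ⟨t0, t1, t2, t3⟩ := twin_zero x
  obtain ⟨u0, u1, u2, u3⟩ := twin_one x
  fin_cases i <;> fin_cases k
  all_goals simp only [t0, t1, t2, t3, u0, u1, u2, u3, Fin.isValue, Fin.zero_eta, Fin.mk_one,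
    Fin.reduceFinMk] at hp hq' ⊢
  all_goals first
    | rw [isRandomMV_iff_zero hδ hLδ hL1 hL4] at hp
    | rw [isRandomMV_iff_one hδ hLδ hL1 hL4] at hp
  all_goals first
    | rw [isRandomMV_iff_zero hδ hLδ hL1 hL4] at hq'
    | rw [isRandomMV_iff_one hδ hLδ hL1 hL4] at hq'
  all_goals simp only [Pi.add_apply, Pi.sub_apply, Pi.single_eq_same, ne_eq, one_ne_zero, zero_ne_one,
    not_false_eq_true, Pi.single_eq_of_ne, add_zero, sub_zero, abs_le, le_abs', true_and, false_and,
    false_or, or_false, Fin.reduceEq] at hp hq' hreg ⊢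
  all_goals omega

/-! ## The vertex regions carry `O(1)` wall corners -/

/-- **At most `5832` wall corners in the vertex regions**: their sites project into the box
`A × A`, `A = [-L, -(L-8)] ∪ [-4, 4] ∪ [L-8, L]` (`27` values), times `2` directions and `4` corners.
[folklore] -/
theorem card_exc_le (A : Finset ((Site 2 × Fin 2) × Fin 4))
    (hA : ∀ q ∈ A, q ∈ T ∧ (L - 8 ≤ |q.1.1 0 + q.1.1 1| ∧ L - 8 ≤ |q.1.1 0 - q.1.1 1|)) :
    A.card ≤ 5832 := by
  classical
  set B : Finset ℤ := Finset.Icc (-L) (-(L - 8)) ∪ (Finset.Icc (-4) 4 ∪ Finset.Icc (L - 8) L) with hB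
  set X : Finset (Site 2) := (B ×ˢ B).image (fun ab : ℤ × ℤ => (![ab.1, ab.2] : Site 2)) with hX
  have hBcard : B.card ≤ 27 := by
    refine (Finset.card_union_le _ _).trans ?_
    refine (Nat.add_le_add_left (Finset.card_union_le _ _) _).trans ?_
    simp only [Int.card_Icc]
    omega
  have hXcard : X.card ≤ 729 := by
    refine Finset.card_image_le.trans ?_
    rw [Finset.card_product]
    exact (Nat.mul_le_mul hBcard hBcard).trans (by norm_num)
  have hsub : A ⊆ (X ×ˢ (Finset.univ : Finset (Fin 2))) ×ˢ (Finset.univ : Finset (Fin 4)) := by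
    intro q hq
    obtain ⟨hqT, hexc⟩ := hA q hq
    have hco := coords_of_mem hδ hLδ hL1 hL hT hqT
    simp only [Finset.mem_product, Finset.mem_univ, and_true, hX, Finset.mem_image]
    refine ⟨(q.1.1 0, q.1.1 1), ?_, Site.eq_iff_two.2 ⟨by simp, by simp⟩⟩
    simp only [le_abs'] at hexc
    simp only [hB, Finset.mem_union, Finset.mem_Icc]
    constructor <;> omega
  refine (Finset.card_le_card hsub).trans ?_
  rw [Finset.card_product, Finset.card_product, Finset.card_univ, Finset.card_univ, Fintype.card_fin,
    Fintype.card_fin]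
  omega

/-! ## The regular upper-left corners, parametrised by the face -/

/-- **The regular horizontal upper-left corners** (`i = 0`, `k = 0`) are exactly `((t-(L-1), t), 0), 0`,
`t ∈ [4, L-5]` (face `F = x`, `d(F) = -(L-1)`, `|s(F)| ≤ L-9`). [folklore] -/
theorem UL_zero_eq (A : Finset ((Site 2 × Fin 2) × Fin 4))
    (hA : ∀ q, q ∈ A ↔ (q ∈ T ∧ ¬ (L - 8 ≤ |q.1.1 0 + q.1.1 1| ∧ L - 8 ≤ |q.1.1 0 - q.1.1 1|)) ∧
      (q.1.2 = 0 ∧ q.2 = 0)) :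
    A = (Finset.Icc 4 (L - 5)).image (fun t : ℤ => (((![t - (L - 1), t] : Site 2), (0 : Fin 2)), (0 : Fin 4))) := by
  have hL4 : 4 ≤ L := by omega
  ext q
  rw [hA, Finset.mem_image]
  constructor
  · rintro ⟨⟨hqT, hreg⟩, hi, hk⟩
    have hc := regular_cases hδ hLδ hL1 hL hT hqT hreg
    obtain ⟨⟨x, i⟩, k⟩ := q
    dsimp only at hi hk hc ⊢
    subst hi hk
    simp only [true_and, zero_ne_one, false_and, false_or, or_false, Fin.reduceEq, abs_le] at hc
    refine ⟨x 1, Finset.mem_Icc.2 ⟨by omega, by omega⟩, ?_⟩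
    refine Prod.ext (Prod.ext (Site.eq_iff_two.2 ⟨?_, ?_⟩) rfl) rfl
    · simp; omega
    · simp
  · rintro ⟨t, ht, rfl⟩
    rw [Finset.mem_Icc] at ht
    refine ⟨⟨(hT _).2 ⟨?_, ?_⟩, ?_⟩, rfl, rfl⟩
    · rw [isRandomMV_iff_zero hδ hLδ hL1 hL4]
      simp only [Matrix.cons_val_zero, Matrix.cons_val_one, Matrix.cons_val_fin_one, abs_le]
      omega
    · rw [(twin_zero _).1, isRandomMV_iff_one hδ hLδ hL1 hL4]
      simp only [Matrix.cons_val_zero, Matrix.cons_val_one, Matrix.cons_val_fin_one, abs_le]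
      omega
    · simp only [Matrix.cons_val_zero, Matrix.cons_val_one, Matrix.cons_val_fin_one, le_abs']
      omega

/-- **The regular vertical upper-left corners** (`i = 1`, `k = 0`) are exactly `((t-(L-2), t), 1), 0`,
`t ∈ [4, L-6]` (face `F = x - e₀ = (t-(L-1), t)`, `d(F) = -(L-1)`, `-(L-8) ≤ s(F) ≤ L-10`). [folklore] -/
theorem UL_one_eq (A : Finset ((Site 2 × Fin 2) × Fin 4))
    (hA : ∀ q, q ∈ A ↔ (q ∈ T ∧ ¬ (L - 8 ≤ |q.1.1 0 + q.1.1 1| ∧ L - 8 ≤ |q.1.1 0 - q.1.1 1|)) ∧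
      (q.1.2 = 1 ∧ q.2 = 0)) :
    A = (Finset.Icc 4 (L - 6)).image (fun t : ℤ => (((![t - (L - 2), t] : Site 2), (1 : Fin 2)), (0 : Fin 4))) := by
  have hL4 : 4 ≤ L := by omega
  ext q
  rw [hA, Finset.mem_image]
  constructor
  · rintro ⟨⟨hqT, hreg⟩, hi, hk⟩
    have hc := regular_cases hδ hLδ hL1 hL hT hqT hreg
    obtain ⟨⟨x, i⟩, k⟩ := q
    dsimp only at hi hk hc ⊢
    subst hi hk
    simp only [true_and, zero_ne_one, false_and, false_or, or_false, Fin.reduceEq, abs_le] at hc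
    refine ⟨x 1, Finset.mem_Icc.2 ⟨by omega, by omega⟩, ?_⟩
    refine Prod.ext (Prod.ext (Site.eq_iff_two.2 ⟨?_, ?_⟩) rfl) rfl
    · simp; omega
    · simp
  · rintro ⟨t, ht, rfl⟩
    rw [Finset.mem_Icc] at ht
    refine ⟨⟨(hT _).2 ⟨?_, ?_⟩, ?_⟩, rfl, rfl⟩
    · rw [isRandomMV_iff_one hδ hLδ hL1 hL4]
      simp only [Matrix.cons_val_zero, Matrix.cons_val_one, Matrix.cons_val_fin_one, abs_le]
      omega
    · rw [(twin_one _).1, isRandomMV_iff_zero hδ hLδ hL1 hL4]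
      simp only [Pi.add_apply, Pi.sub_apply, Matrix.cons_val_zero, Matrix.cons_val_one, Matrix.cons_val_fin_one,
        Pi.single_eq_same, ne_eq, one_ne_zero, zero_ne_one, not_false_eq_true, Pi.single_eq_of_ne, add_zero,
        sub_zero, abs_le]
      omega
    · simp only [Matrix.cons_val_zero, Matrix.cons_val_one, Matrix.cons_val_fin_one, le_abs']
      omega

/-! ## The free-side window -/

/-- **The window corners are regular free-side wall corners**: for `t ∈ [L/4, 3(L/4) - 3]`, the index
`(((t, L-3-t), 0), 1)` is a wall corner off the vertex regions, and its wall site `(t, L-3-t) + e₀` has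
level `L - 2` and `2|d| ≤ L + 2`. [folklore] -/
theorem window_mem {t : ℤ} (ht : t ∈ Finset.Icc (L / 4) (3 * (L / 4) - 3)) :
    ((((![t, L - 3 - t] : Site 2), (0 : Fin 2)), (1 : Fin 4)) ∈ T ∧
      ¬ (L - 8 ≤ |(![t, L - 3 - t] : Site 2) 0 + (![t, L - 3 - t] : Site 2) 1| ∧
        L - 8 ≤ |(![t, L - 3 - t] : Site 2) 0 - (![t, L - 3 - t] : Site 2) 1|)) ∧
    (((![t, L - 3 - t] : Site 2) + cornerUnit 0) 0 + ((![t, L - 3 - t] : Site 2) + cornerUnit 0) 1 = L - 2 ∧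
      2 * |((![t, L - 3 - t] : Site 2) + cornerUnit 0) 0 - ((![t, L - 3 - t] : Site 2) + cornerUnit 0) 1| ≤
        L + 2) := by
  have hL4 : 4 ≤ L := by omega
  rw [Finset.mem_Icc] at ht
  refine ⟨⟨(hT _).2 ⟨?_, ?_⟩, ?_⟩, ?_, ?_⟩
  · rw [isRandomMV_iff_zero hδ hLδ hL1 hL4]
    simp only [Matrix.cons_val_zero, Matrix.cons_val_one, Matrix.cons_val_fin_one, abs_le]
    omega
  · rw [(twin_zero _).2.1, isRandomMV_iff_one hδ hLδ hL1 hL4]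
    simp only [Pi.add_apply, Matrix.cons_val_zero, Matrix.cons_val_one, Matrix.cons_val_fin_one,
      Pi.single_eq_same, ne_eq, one_ne_zero, not_false_eq_true, Pi.single_eq_of_ne, add_zero, abs_le]
    omega
  · simp only [Matrix.cons_val_zero, Matrix.cons_val_one, Matrix.cons_val_fin_one, le_abs']
    omega
  · simp [cornerUnit]; omega
  · simp only [cornerUnit, Pi.add_apply, Matrix.cons_val_zero, Matrix.cons_val_one, Matrix.cons_val_fin_one,
      Pi.single_eq_same, ne_eq, one_ne_zero, not_false_eq_true, Pi.single_eq_of_ne, add_zero]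
    rcases abs_choice (t + 1 - (L - 3 - t)) with h | h <;> omega

omit hδ hLδ hL1 hT in
/-- **The window is long**: `L/4 ≤ #[L/4, 3(L/4) - 3]` for `L ≥ 16`. [folklore] -/
theorem card_window : (L : ℝ) / 4 ≤ ((Finset.Icc (L / 4) (3 * (L / 4) - 3)).card : ℝ) := by
  have h : (((Finset.Icc (L / 4) (3 * (L / 4) - 3)).card : ℕ) : ℤ) = 3 * (L / 4) - 3 + 1 - L / 4 :=
    Int.card_Icc_of_le _ _ (by omega)
  have h' : L ≤ 4 * (((Finset.Icc (L / 4) (3 * (L / 4) - 3)).card : ℕ) : ℤ) := by rw [h]; omega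
  have h'' : (L : ℝ) ≤ 4 * (((Finset.Icc (L / 4) (3 * (L / 4) - 3)).card : ℕ) : ℝ) := by exact_mod_cast h'
  linarith

end Level

/-! ## Injectivity of the parametrisations (for `Finset.sum_image`) -/

/-- The parametrisations `t ↦ (((a t, t), i), k)` and `t ↦ (((t, b t), i), k)` are injective. [folklore] -/
theorem injective_param (a b : ℤ → ℤ) (i : Fin 2) (k : Fin 4) :
    Function.Injective (fun t : ℤ => (((![a t, t] : Site 2), i), k)) ∧
      Function.Injective (fun t : ℤ => (((![t, b t] : Site 2), i), k)) := by
  constructor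
  · intro t t' h
    have := congrFun (congrArg Prod.fst (congrArg Prod.fst h)) 1
    simpa using this
  · intro t t' h
    have := congrFun (congrArg Prod.fst (congrArg Prod.fst h)) 0
    simpa using this

end AnchorCount

open AnchorCount in
/-- **Registered helper `stub_anchorMomentCount`** (of the stub `stub_anchorMoment_of_IP`, line
`strip-anchored-vertex-normalisation`, skeleton r4): for `0 < δ`, `L δ < 2 ≤ (L + 1) δ`, `16 ≤ L`, in any finite
set `T` consisting exactly of the wall corners of the concrete anchor data `anchorData δ`, at most `5832` members lie
in the vertex regions `{L - 8 ≤ |s| ∧ L - 8 ≤ |d|}`. [folklore] -/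
theorem stub_anchorMomentCount : ∀ (δ : ℝ) (L : ℤ), 0 < δ → (L : ℝ) * δ < 2 → 2 ≤ ((L : ℝ) + 1) * δ → 16 ≤ L → ∀ T : Finset ((Site 2 × Fin 2) × Fin 4), (∀ q, q ∈ T ↔ IsRandomMV (anchorData δ) q.1 ∧ ¬ IsRandomMV (anchorData δ) (twin q.1.1 q.1.2 q.2)) → (T.filter (fun q => L - 8 ≤ |q.1.1 0 + q.1.1 1| ∧ L - 8 ≤ |q.1.1 0 - q.1.1 1|)).card ≤ 5832 := by
  intro δ L hδ hLδ hL1 hL T hT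
  exact card_exc_le hδ hLδ hL1 hL hT _ (fun q hq => by simpa [Finset.mem_filter] using hq)

end Summit.CriticalPhenomena.CardyFormulaZ2.Theorems.ParafermionFamiliesToSLESix.StripAnchored

end
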